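import Mathlib.Analysis.Calculus.UniformLimitsDeriv
import Mathlib.Analysis.Calculus.ContDiff.Operations
import Literature.Analysis.FunctionSpaces.HolderSpace
import HarnessLib

/-!
# The Banach space `C^{k,r}_b(E, F)` of `C^k` functions with bounded derivatives and Hölder
# continuous `k`-th derivative (Hölder spaces, part 3)

Topic `Literature/Analysis/FunctionSpaces`. Part 1 (`HolderNorm.lean`) defines the class
`MemContDiffHolder k r f` (`f` is `C^k`, `D^j f` bounded for `j ≤ k`, `D^k f` `r`-Hölder) and the
extended norm `eContDiffHolderNorm k r f = ∑_{j ≤ k} ‖D^j f‖_∞ + [D^k f]_r`; part 2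
(`HolderSpace.lean`) bundles `k = 0` into the Banach space `BoundedHolderFunction X Y r` and leaves
"`C^{k,α}` for `k ≥ 1`" as a predicate. This file bundles every `k`:

* `ContDiffHolderFunction E F k r` — functions `E → F` in `MemContDiffHolder k r` on a real normed
  space `E`, with `FunLike`, the pointwise real vector space structure, and the sup norms
  `supNormDeriv f j = sup_x ‖D^j f(x)‖` of the derivatives (Mathlib's `iteratedFDeriv`);
* the norm `‖f‖ = ∑_{j ≤ k} sup_x ‖D^j f(x)‖ + [D^k f]_r` (Gilbarg–Trudinger 2001, §4.1, (4.6);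
  Evans 2010, §5.1), making it a real normed space, with `norm_eq_toReal_eContDiffHolderNorm`
  (the bundled norm IS the printed norm of part 1) and the bounds `norm_iteratedFDeriv_le_norm`,
  `norm_apply_le_norm`, `nnHolderNorm_le_norm`, `evalCLM`;
* **completeness** (`instCompleteSpace`; Evans 2010, §5.1, Theorem 1: "`C^{k,γ}(Ū)` is a Banach
  space"; Gilbarg–Trudinger §4.1): along a Cauchy sequence every `D^j u_n`, `j ≤ k`, is uniformly
  Cauchy (`‖D^j(u_n − u_m)(x)‖ ≤ ‖u_n − u_m‖`), hence converges uniformly to some `G_j`; by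
  Mathlib's `hasFDerivAt_of_tendstoUniformly`, inductively in `j` (`fderiv_iteratedFDeriv`,
  `iteratedFDeriv_succ_eq_comp_left`), the limit `g` of the values is `C^k` with `D^j g = G_j`;
  the Hölder bound of the tail passes to the pointwise limit as in part 2
  (`[D^k u_n − D^k g]_r ≤ ε` eventually), so `g ∈ C^{k,r}_b` and `‖u_n − g‖ → 0`.

Everything is proved; no named facts. This is the function-space layer under Schauder theory
(Gilbarg–Trudinger Ch. 6 works in `C^{2,α}`), cf. the census of
`Literature.Geometry.Riemannian.gurskyViaclovsky_pathOpen_weighted_four`.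

## Design notes

* All norms of derivatives are taken pointwise (`‖iteratedFDeriv ℝ j f x‖`, real suprema
  `⨆ x, ·`): bundling `D^j f` into `E →ᵇ (E [×j]→L[ℝ] F)` makes instance search on that type
  diverge (normed-space instances of bounded continuous functions with values in continuous
  multilinear maps time out), so part 2 is not applied to `D^k f` but its limit argument is redone
  pointwise (`eventually_holderWith_iteratedFDeriv_sub`).
* The norm is real-valued and built by hand from an `AddGroupNorm` (as in part 2 and
  `C1HolderMap.lean`), so that it is literally `∑_{j ≤ k} ‖D^j f‖_∞ + [D^k f]_r`.

## References

* D. Gilbarg, N. S. Trudinger, *Elliptic Partial Differential Equations of Second Order* (2001),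
  §4.1, (4.5)–(4.6). [GilbargTrudinger2001]
* L. C. Evans, *Partial Differential Equations*, 2nd ed. (2010), §5.1, Theorem 1. [Evans2010]
-/

noncomputable section

open Set Filter Topology
open scoped NNReal ENNReal

namespace Literature.Analysis.FunctionSpaces

/-- **The space `C^{k,r}_b(E, F)`**: functions `E → F` of class `C^k` whose derivatives
`D^j f`, `j ≤ k`, are bounded and whose `k`-th derivative is `r`-Hölder (the class
`MemContDiffHolder k r` of `HolderNorm.lean`; Gilbarg–Trudinger §4.1, Evans §5.1). [cite: GilbargTrudinger2001, §4.1] -/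
structure ContDiffHolderFunction (E F : Type*) [NormedAddCommGroup E] [NormedSpace ℝ E]
    [NormedAddCommGroup F] [NormedSpace ℝ F] (k : ℕ) (r : ℝ≥0) where
  /-- The underlying function. -/
  toFun : E → F
  /-- The function is in the class `C^{k,r}_b`. -/
  memContDiffHolder' : MemContDiffHolder k r toFun

namespace ContDiffHolderFunction

variable {E F : Type*} [NormedAddCommGroup E] [NormedSpace ℝ E] [NormedAddCommGroup F]
  [NormedSpace ℝ F] {k : ℕ} {r : ℝ≥0}

/-- `C^{k,r}_b(E, F)` is a type of functions `E → F`. [folklore] -/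
instance instFunLike : FunLike (ContDiffHolderFunction E F k r) E F where
  coe := toFun
  coe_injective f g h := by cases f; cases g; congr

/-- Extensionality. [folklore] -/
@[ext]
theorem ext {f g : ContDiffHolderFunction E F k r} (h : ∀ x, f x = g x) : f = g :=
  DFunLike.ext f g h

/-- The coercion of the constructor. [folklore] -/
@[simp]
theorem coe_mk (f : E → F) (hf : MemContDiffHolder k r f) :
    ((⟨f, hf⟩ : ContDiffHolderFunction E F k r) : E → F) = f := rfl

/-- Elements are in the class `MemContDiffHolder k r`. [folklore] -/
theorem memContDiffHolder (f : ContDiffHolderFunction E F k r) :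
    MemContDiffHolder k r (f : E → F) := f.memContDiffHolder'

/-- Elements are `C^k`. [folklore] -/
theorem contDiff (f : ContDiffHolderFunction E F k r) : ContDiff ℝ k (f : E → F) :=
  f.memContDiffHolder.contDiff

/-- Elements are `C^j` for `j ≤ k`. [folklore] -/
theorem contDiff_of_le (f : ContDiffHolderFunction E F k r) {j : ℕ} (hj : j ≤ k) :
    ContDiff ℝ j (f : E → F) :=
  f.contDiff.of_le (by exact_mod_cast hj)

/-- Elements are continuous. [folklore] -/
theorem continuous (f : ContDiffHolderFunction E F k r) : Continuous (f : E → F) :=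
  f.contDiff.continuous

/-- The derivatives `D^j f`, `j ≤ k`, are continuous. [folklore] -/
theorem continuous_iteratedFDeriv (f : ContDiffHolderFunction E F k r) {j : ℕ} (hj : j ≤ k) :
    Continuous (iteratedFDeriv ℝ j (f : E → F)) :=
  f.contDiff.continuous_iteratedFDeriv (by exact_mod_cast hj)

/-- The derivatives `D^j f`, `j ≤ k`, are bounded. [folklore] -/
theorem exists_norm_iteratedFDeriv_le (f : ContDiffHolderFunction E F k r) {j : ℕ} (hj : j ≤ k) :
    ∃ C : ℝ, ∀ x, ‖iteratedFDeriv ℝ j (f : E → F) x‖ ≤ C :=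
  eSupNorm_lt_top_iff.1 (f.memContDiffHolder.2.1 j hj)

/-- The top derivative `D^k f` is `r`-Hölder. [folklore] -/
theorem memHolder (f : ContDiffHolderFunction E F k r) :
    MemHolder r (iteratedFDeriv ℝ k (f : E → F)) :=
  f.memContDiffHolder.2.2

/-! ### The sup norms of the derivatives -/

/-- **`sup_x ‖D^j f(x)‖`**, the sup norm of the `j`-th derivative (a real supremum; for `j ≤ k`
the set is bounded, `bddAbove_range_norm_iteratedFDeriv`). [folklore] -/
def supNormDeriv (f : ContDiffHolderFunction E F k r) (j : ℕ) : ℝ :=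
  ⨆ x, ‖iteratedFDeriv ℝ j (f : E → F) x‖

/-- For `j ≤ k` the norms `‖D^j f(x)‖` are bounded above. [folklore] -/
theorem bddAbove_range_norm_iteratedFDeriv (f : ContDiffHolderFunction E F k r) {j : ℕ}
    (hj : j ≤ k) : BddAbove (Set.range fun x => ‖iteratedFDeriv ℝ j (f : E → F) x‖) := by
  obtain ⟨C, hC⟩ := f.exists_norm_iteratedFDeriv_le hj
  exact ⟨C, by rintro _ ⟨x, rfl⟩; exact hC x⟩

/-- `sup_x ‖D^j f(x)‖ ≥ 0`. [folklore] -/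
theorem supNormDeriv_nonneg (f : ContDiffHolderFunction E F k r) (j : ℕ) : 0 ≤ f.supNormDeriv j :=
  Real.iSup_nonneg fun _ => norm_nonneg _

/-- **`‖D^j f(x)‖ ≤ sup_x ‖D^j f(x)‖`** for `j ≤ k`. [folklore] -/
theorem norm_iteratedFDeriv_le_supNormDeriv (f : ContDiffHolderFunction E F k r) {j : ℕ}
    (hj : j ≤ k) (x : E) : ‖iteratedFDeriv ℝ j (f : E → F) x‖ ≤ f.supNormDeriv j :=
  le_ciSup (f.bddAbove_range_norm_iteratedFDeriv hj) x

/-- A uniform bound on `‖D^j f(x)‖` bounds the sup norm. [folklore] -/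
theorem supNormDeriv_le (f : ContDiffHolderFunction E F k r) (j : ℕ) {C : ℝ} (hC : 0 ≤ C)
    (h : ∀ x, ‖iteratedFDeriv ℝ j (f : E → F) x‖ ≤ C) : f.supNormDeriv j ≤ C :=
  Real.iSup_le h hC

/-! ### Algebraic structure (pointwise) -/

/-- `MemContDiffHolder` contains `0`. [folklore] -/
theorem _root_.Literature.Analysis.FunctionSpaces.memContDiffHolder_zero_fun :
    MemContDiffHolder k r (0 : E → F) := by
  refine ⟨contDiff_zero_fun, fun j _ => ?_, ?_⟩
  · rw [iteratedFDeriv_zero, eSupNorm_zero]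
    exact ENNReal.zero_lt_top
  · rw [iteratedFDeriv_zero]
    exact memHolder_zero

/-- `MemContDiffHolder` is closed under addition. [folklore] -/
theorem _root_.Literature.Analysis.FunctionSpaces.MemContDiffHolder.add {f g : E → F}
    (hf : MemContDiffHolder k r f) (hg : MemContDiffHolder k r g) :
    MemContDiffHolder k r (f + g) := by
  refine ⟨hf.1.add hg.1, fun j hj => ?_, ?_⟩
  · rw [iteratedFDeriv_add (hf.1.of_le (by exact_mod_cast hj)) (hg.1.of_le (by exact_mod_cast hj))]
    exact (eSupNorm_add_le _ _).trans_lt (ENNReal.add_lt_top.2 ⟨hf.2.1 j hj, hg.2.1 j hj⟩)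
  · rw [iteratedFDeriv_add (hf.1.of_le le_rfl) (hg.1.of_le le_rfl)]
    exact hf.2.2.add hg.2.2

/-- `MemContDiffHolder` is closed under negation. [folklore] -/
theorem _root_.Literature.Analysis.FunctionSpaces.MemContDiffHolder.neg {f : E → F}
    (hf : MemContDiffHolder k r f) : MemContDiffHolder k r (-f) := by
  refine ⟨hf.1.neg, fun j hj => ?_, ?_⟩
  · rw [iteratedFDeriv_neg, eSupNorm_neg]
    exact hf.2.1 j hj
  · rw [iteratedFDeriv_neg]
    exact hf.2.2.neg'

/-- `MemContDiffHolder` is closed under real scalar multiplication. [folklore] -/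
theorem _root_.Literature.Analysis.FunctionSpaces.MemContDiffHolder.const_smul {f : E → F}
    (hf : MemContDiffHolder k r f) (c : ℝ) : MemContDiffHolder k r (c • f) := by
  have hD : ∀ j ≤ k, iteratedFDeriv ℝ j (c • f) = c • iteratedFDeriv ℝ j f := fun j hj =>
    funext fun x => iteratedFDeriv_const_smul_apply ((hf.1.of_le (by exact_mod_cast hj)).contDiffAt)
  refine ⟨hf.1.const_smul c, fun j hj => ?_, ?_⟩
  · rw [hD j hj]
    obtain ⟨C, hC⟩ := eSupNorm_lt_top_iff.1 (hf.2.1 j hj)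
    refine eSupNorm_lt_top_iff.2 ⟨‖c‖ * C, fun x => ?_⟩
    rw [Pi.smul_apply, norm_smul]
    exact mul_le_mul_of_nonneg_left (hC x) (norm_nonneg c)
  · rw [hD k le_rfl]
    exact hf.2.2.smul

/-- The zero function. [folklore] -/
instance instZero : Zero (ContDiffHolderFunction E F k r) :=
  ⟨⟨0, memContDiffHolder_zero_fun⟩⟩

/-- Pointwise addition. [folklore] -/
instance instAdd : Add (ContDiffHolderFunction E F k r) :=
  ⟨fun f g => ⟨⇑f + ⇑g, f.memContDiffHolder.add g.memContDiffHolder⟩⟩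

/-- Pointwise negation. [folklore] -/
instance instNeg : Neg (ContDiffHolderFunction E F k r) :=
  ⟨fun f => ⟨-⇑f, f.memContDiffHolder.neg⟩⟩

/-- Pointwise subtraction. [folklore] -/
instance instSub : Sub (ContDiffHolderFunction E F k r) :=
  ⟨fun f g => ⟨⇑f - ⇑g, by
    simpa [sub_eq_add_neg] using f.memContDiffHolder.add g.memContDiffHolder.neg⟩⟩

/-- Real scalar multiplication. [folklore] -/
instance instSMul : SMul ℝ (ContDiffHolderFunction E F k r) :=
  ⟨fun c f => ⟨c • ⇑f, f.memContDiffHolder.const_smul c⟩⟩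

/-- Natural scalar multiplication (through the real one). [folklore] -/
instance instNSMul : SMul ℕ (ContDiffHolderFunction E F k r) :=
  ⟨fun n f => (n : ℝ) • f⟩

/-- Integer scalar multiplication (through the real one). [folklore] -/
instance instZSMul : SMul ℤ (ContDiffHolderFunction E F k r) :=
  ⟨fun n f => (n : ℝ) • f⟩

/-- The zero element is the zero function. [folklore] -/
@[simp] theorem coe_zero : ((0 : ContDiffHolderFunction E F k r) : E → F) = 0 := rfl

/-- Addition is pointwise. [folklore] -/
@[simp] theorem coe_add (f g : ContDiffHolderFunction E F k r) : ⇑(f + g) = f + g := rfl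

/-- Negation is pointwise. [folklore] -/
@[simp] theorem coe_neg (f : ContDiffHolderFunction E F k r) : ⇑(-f) = -f := rfl

/-- Subtraction is pointwise. [folklore] -/
@[simp] theorem coe_sub (f g : ContDiffHolderFunction E F k r) : ⇑(f - g) = f - g := rfl

/-- Real scalar multiplication is pointwise. [folklore] -/
@[simp] theorem coe_smul (c : ℝ) (f : ContDiffHolderFunction E F k r) : ⇑(c • f) = c • f := rfl

/-- Natural scalar multiplication is pointwise. [folklore] -/
theorem coe_nsmul (n : ℕ) (f : ContDiffHolderFunction E F k r) : ⇑(n • f) = n • (f : E → F) := by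
  show ((n : ℝ) • f : E → F) = n • (f : E → F)
  funext x
  simp [Nat.cast_smul_eq_nsmul]

/-- Integer scalar multiplication is pointwise. [folklore] -/
theorem coe_zsmul (n : ℤ) (f : ContDiffHolderFunction E F k r) : ⇑(n • f) = n • (f : E → F) := by
  show ((n : ℝ) • f : E → F) = n • (f : E → F)
  funext x
  simp [Int.cast_smul_eq_zsmul]

/-- `C^{k,r}_b(E, F)` is an additive commutative group (pulled back from `E → F`). [folklore] -/
instance instAddCommGroup : AddCommGroup (ContDiffHolderFunction E F k r) :=
  DFunLike.coe_injective.addCommGroup _ coe_zero coe_add coe_neg coe_sub (fun f n => coe_nsmul n f)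
    (fun f n => coe_zsmul n f)

/-- The coercion to functions as an additive monoid homomorphism. [folklore] -/
def coeAddHom : ContDiffHolderFunction E F k r →+ (E → F) where
  toFun := (⇑)
  map_zero' := coe_zero
  map_add' := coe_add

/-- `C^{k,r}_b(E, F)` is a real vector space (pulled back from `E → F`). [folklore] -/
instance instModule : Module ℝ (ContDiffHolderFunction E F k r) :=
  DFunLike.coe_injective.module ℝ coeAddHom coe_smul

/-- `D^j(f + g)(x) = D^j f(x) + D^j g(x)` for `j ≤ k`. [folklore] -/
theorem iteratedFDeriv_add_apply' (f g : ContDiffHolderFunction E F k r) {j : ℕ} (hj : j ≤ k)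
    (x : E) : iteratedFDeriv ℝ j ((f + g : ContDiffHolderFunction E F k r) : E → F) x =
      iteratedFDeriv ℝ j (f : E → F) x + iteratedFDeriv ℝ j (g : E → F) x := by
  rw [coe_add]
  exact iteratedFDeriv_add_apply (f.contDiff_of_le hj).contDiffAt (g.contDiff_of_le hj).contDiffAt

/-- `D^j(f − g)(x) = D^j f(x) − D^j g(x)` for `j ≤ k`. [folklore] -/
theorem iteratedFDeriv_sub_apply' (f g : ContDiffHolderFunction E F k r) {j : ℕ} (hj : j ≤ k)
    (x : E) : iteratedFDeriv ℝ j ((f - g : ContDiffHolderFunction E F k r) : E → F) x =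
      iteratedFDeriv ℝ j (f : E → F) x - iteratedFDeriv ℝ j (g : E → F) x := by
  rw [coe_sub]
  exact iteratedFDeriv_sub_apply (f.contDiff_of_le hj).contDiffAt (g.contDiff_of_le hj).contDiffAt

/-- `D^j(−f) = −D^j f`. [folklore] -/
theorem iteratedFDeriv_neg' (f : ContDiffHolderFunction E F k r) (j : ℕ) :
    iteratedFDeriv ℝ j ((-f : ContDiffHolderFunction E F k r) : E → F) =
      -iteratedFDeriv ℝ j (f : E → F) := by
  rw [coe_neg, iteratedFDeriv_neg]

/-- `D^j(c • f)(x) = c • D^j f(x)` for `j ≤ k`. [folklore] -/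
theorem iteratedFDeriv_smul_apply' (c : ℝ) (f : ContDiffHolderFunction E F k r) {j : ℕ}
    (hj : j ≤ k) (x : E) : iteratedFDeriv ℝ j ((c • f : ContDiffHolderFunction E F k r) : E → F) x =
      c • iteratedFDeriv ℝ j (f : E → F) x := by
  rw [coe_smul]
  exact iteratedFDeriv_const_smul_apply (f.contDiff_of_le hj).contDiffAt

/-- `sup_x ‖D^j 0‖ = 0`. [folklore] -/
@[simp]
theorem supNormDeriv_zero (j : ℕ) : (0 : ContDiffHolderFunction E F k r).supNormDeriv j = 0 := by
  simp only [supNormDeriv, coe_zero, iteratedFDeriv_zero, Pi.zero_apply, norm_zero]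
  exact Real.iSup_const_zero

/-- Subadditivity of the sup norms of the derivatives (`j ≤ k`). [folklore] -/
theorem supNormDeriv_add_le (f g : ContDiffHolderFunction E F k r) {j : ℕ} (hj : j ≤ k) :
    (f + g).supNormDeriv j ≤ f.supNormDeriv j + g.supNormDeriv j := by
  refine supNormDeriv_le _ j (add_nonneg (f.supNormDeriv_nonneg j) (g.supNormDeriv_nonneg j))
    fun x => ?_
  rw [iteratedFDeriv_add_apply' f g hj]
  exact (norm_add_le _ _).trans (add_le_add (f.norm_iteratedFDeriv_le_supNormDeriv hj x)
    (g.norm_iteratedFDeriv_le_supNormDeriv hj x))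

/-- The sup norms of the derivatives of `−f` are those of `f`. [folklore] -/
theorem supNormDeriv_neg (f : ContDiffHolderFunction E F k r) (j : ℕ) :
    (-f).supNormDeriv j = f.supNormDeriv j := by
  simp only [supNormDeriv, iteratedFDeriv_neg' f j, Pi.neg_apply, norm_neg]

/-- Homogeneity of the sup norms of the derivatives (`j ≤ k`). [folklore] -/
theorem supNormDeriv_smul (c : ℝ) (f : ContDiffHolderFunction E F k r) {j : ℕ} (hj : j ≤ k) :
    (c • f).supNormDeriv j = ‖c‖ * f.supNormDeriv j := by
  simp only [supNormDeriv]
  rw [Real.mul_iSup_of_nonneg (norm_nonneg c)]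
  exact iSup_congr fun x => by rw [iteratedFDeriv_smul_apply' c f hj, norm_smul]

/-! ### The norm `‖f‖ = ∑_{j ≤ k} ‖D^j f‖_∞ + [D^k f]_r` -/

/-- **The `C^{k,r}` norm** `‖f‖ = ∑_{j ≤ k} sup_x ‖D^j f(x)‖ + [D^k f]_r` (Gilbarg–Trudinger §4.1,
(4.6); Evans §5.1). [cite: GilbargTrudinger2001, §4.1 (4.6)] -/
instance instNorm : Norm (ContDiffHolderFunction E F k r) :=
  ⟨fun f => (∑ j ∈ Finset.range (k + 1), f.supNormDeriv j) +
    nnHolderNorm r (iteratedFDeriv ℝ k (f : E → F))⟩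

/-- Unfolding the norm. [folklore] -/
theorem norm_def (f : ContDiffHolderFunction E F k r) :
    ‖f‖ = (∑ j ∈ Finset.range (k + 1), f.supNormDeriv j) +
      nnHolderNorm r (iteratedFDeriv ℝ k (f : E → F)) := rfl

/-- The sum of the sup norms of the derivatives is bounded by the norm. [folklore] -/
theorem sum_supNormDeriv_le_norm (f : ContDiffHolderFunction E F k r) :
    ∑ j ∈ Finset.range (k + 1), f.supNormDeriv j ≤ ‖f‖ :=
  le_add_of_nonneg_right (NNReal.coe_nonneg _)

/-- Each sup norm `sup_x ‖D^j f(x)‖`, `j ≤ k`, is bounded by the norm. [folklore] -/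
theorem supNormDeriv_le_norm (f : ContDiffHolderFunction E F k r) {j : ℕ} (hj : j ≤ k) :
    f.supNormDeriv j ≤ ‖f‖ := by
  refine le_trans ?_ f.sum_supNormDeriv_le_norm
  exact Finset.single_le_sum (f := fun i => f.supNormDeriv i) (fun i _ => f.supNormDeriv_nonneg i)
    (Finset.mem_range.2 (Nat.lt_succ_of_le hj))

/-- The Hölder seminorm of the top derivative is bounded by the norm. [folklore] -/
theorem nnHolderNorm_le_norm (f : ContDiffHolderFunction E F k r) :
    (nnHolderNorm r (iteratedFDeriv ℝ k (f : E → F)) : ℝ) ≤ ‖f‖ :=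
  le_add_of_nonneg_left (Finset.sum_nonneg fun j _ => f.supNormDeriv_nonneg j)

/-- **`‖D^j f(x)‖ ≤ ‖f‖_{C^{k,r}}`** for `j ≤ k`. [folklore] -/
theorem norm_iteratedFDeriv_le_norm (f : ContDiffHolderFunction E F k r) {j : ℕ} (hj : j ≤ k)
    (x : E) : ‖iteratedFDeriv ℝ j (f : E → F) x‖ ≤ ‖f‖ :=
  (f.norm_iteratedFDeriv_le_supNormDeriv hj x).trans (f.supNormDeriv_le_norm hj)

/-- **`‖f(x)‖ ≤ ‖f‖_{C^{k,r}}`**. [folklore] -/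
theorem norm_apply_le_norm (f : ContDiffHolderFunction E F k r) (x : E) : ‖f x‖ ≤ ‖f‖ := by
  rw [← norm_iteratedFDeriv_zero (𝕜 := ℝ)]
  exact f.norm_iteratedFDeriv_le_norm (Nat.zero_le k) x

/-- The norm is nonnegative. [folklore] -/
theorem norm_nonneg' (f : ContDiffHolderFunction E F k r) : 0 ≤ ‖f‖ :=
  add_nonneg (Finset.sum_nonneg fun j _ => f.supNormDeriv_nonneg j) (NNReal.coe_nonneg _)

/-- The norm of `-f` is that of `f`. [folklore] -/
theorem norm_neg' (f : ContDiffHolderFunction E F k r) : ‖-f‖ = ‖f‖ := by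
  have h2 : nnHolderNorm r (iteratedFDeriv ℝ k ((-f : ContDiffHolderFunction E F k r) : E → F)) =
      nnHolderNorm r (iteratedFDeriv ℝ k (f : E → F)) := by
    rw [iteratedFDeriv_neg' f k]
    have h := f.memHolder.nnHolderNorm_smul (-1 : ℝ)
    rw [neg_one_smul, nnnorm_neg, nnnorm_one, one_mul] at h
    exact h
  rw [norm_def, norm_def, h2, Finset.sum_congr rfl fun j _ => supNormDeriv_neg f j]

/-- Triangle inequality. [folklore] -/
theorem norm_add_le' (f g : ContDiffHolderFunction E F k r) : ‖f + g‖ ≤ ‖f‖ + ‖g‖ := by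
  rw [norm_def, norm_def, norm_def]
  have h₁ : ∑ j ∈ Finset.range (k + 1), (f + g).supNormDeriv j ≤
      ∑ j ∈ Finset.range (k + 1), f.supNormDeriv j + ∑ j ∈ Finset.range (k + 1), g.supNormDeriv j := by
    rw [← Finset.sum_add_distrib]
    exact Finset.sum_le_sum fun j hj =>
      supNormDeriv_add_le f g (Nat.lt_succ_iff.1 (Finset.mem_range.1 hj))
  have h₂ : (nnHolderNorm r (iteratedFDeriv ℝ k ((f + g : ContDiffHolderFunction E F k r) : E → F)) : ℝ)
      ≤ nnHolderNorm r (iteratedFDeriv ℝ k (f : E → F)) +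
        nnHolderNorm r (iteratedFDeriv ℝ k (g : E → F)) := by
    rw [coe_add, iteratedFDeriv_add (f.contDiff_of_le le_rfl) (g.contDiff_of_le le_rfl)]
    exact_mod_cast f.memHolder.nnHolderNorm_add_le g.memHolder
  linarith

/-- **Definiteness**: only `0` has norm `0` (the `j = 0` term of the norm controls the values). [folklore] -/
theorem eq_zero_of_norm_eq_zero {f : ContDiffHolderFunction E F k r} (h : ‖f‖ = 0) : f = 0 := by
  ext x
  have hx : ‖f x‖ ≤ 0 := (f.norm_apply_le_norm x).trans h.le
  rw [coe_zero, Pi.zero_apply]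
  exact norm_le_zero_iff.1 hx

/-- The norm as an `AddGroupNorm`. [folklore] -/
def addGroupNorm : AddGroupNorm (ContDiffHolderFunction E F k r) where
  toFun f := ‖f‖
  map_zero' := by
    rw [norm_def, Finset.sum_congr rfl fun j _ => supNormDeriv_zero (E := E) (F := F) (k := k) (r := r) j,
      Finset.sum_const_zero, zero_add, coe_zero, iteratedFDeriv_zero, nnHolderNorm_zero, NNReal.coe_zero]
  add_le' := norm_add_le'
  neg' := norm_neg'
  eq_zero_of_map_eq_zero' _ := eq_zero_of_norm_eq_zero

/-- `C^{k,r}_b(E, F)` is a normed additive commutative group for the `C^{k,r}` norm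
(Gilbarg–Trudinger §4.1). [folklore] -/
instance instNormedAddCommGroup : NormedAddCommGroup (ContDiffHolderFunction E F k r) :=
  { AddGroupNorm.toNormedAddCommGroup addGroupNorm with
    norm := fun f => ‖f‖
    dist := fun f g => ‖-f + g‖ }

/-- Homogeneity of the norm. [folklore] -/
theorem norm_smul' (c : ℝ) (f : ContDiffHolderFunction E F k r) : ‖c • f‖ = ‖c‖ * ‖f‖ := by
  rw [norm_def, norm_def, mul_add, Finset.mul_sum]
  congr 1
  · exact Finset.sum_congr rfl fun j hj =>
      supNormDeriv_smul c f (Nat.lt_succ_iff.1 (Finset.mem_range.1 hj))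
  · have hD : iteratedFDeriv ℝ k ((c • f : ContDiffHolderFunction E F k r) : E → F) =
        c • iteratedFDeriv ℝ k (f : E → F) :=
      funext fun x => iteratedFDeriv_smul_apply' c f le_rfl x
    rw [hD, f.memHolder.nnHolderNorm_smul c, NNReal.coe_mul, coe_nnnorm]

/-- `C^{k,r}_b(E, F)` is a real normed space (Gilbarg–Trudinger §4.1). [folklore] -/
instance instNormedSpace : NormedSpace ℝ (ContDiffHolderFunction E F k r) where
  norm_smul_le c f := (norm_smul' c f).le

/-! ### The bundled norm is the printed `C^{k,r}` norm of `HolderNorm.lean` -/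

/-- For `j ≤ k`, the extended sup norm `eSupNorm (D^j f)` of part 1 is the real sup norm
`sup_x ‖D^j f(x)‖`. [folklore] -/
theorem eSupNorm_iteratedFDeriv_eq (f : ContDiffHolderFunction E F k r) {j : ℕ} (hj : j ≤ k) :
    eSupNorm (iteratedFDeriv ℝ j (f : E → F)) = ENNReal.ofReal (f.supNormDeriv j) := by
  refine le_antisymm (iSup_le fun x => ?_) ?_
  · rw [← ofReal_norm]
    exact ENNReal.ofReal_le_ofReal (f.norm_iteratedFDeriv_le_supNormDeriv hj x)
  · have hfin : eSupNorm (iteratedFDeriv ℝ j (f : E → F)) < ∞ := f.memContDiffHolder.2.1 j hj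
    rw [← ENNReal.ofReal_toReal hfin.ne]
    refine ENNReal.ofReal_le_ofReal (f.supNormDeriv_le j ENNReal.toReal_nonneg fun x => ?_)
    have hx : ‖iteratedFDeriv ℝ j (f : E → F) x‖ₑ ≤ eSupNorm (iteratedFDeriv ℝ j (f : E → F)) :=
      enorm_le_eSupNorm _ x
    have := ENNReal.toReal_mono hfin.ne hx
    simpa using this

/-- **The bundled norm is the printed norm**: `‖f‖ = (eContDiffHolderNorm k r f).toReal`, where
`eContDiffHolderNorm k r f = ∑_{j ≤ k} ‖D^j f‖_∞ + [D^k f]_r` is the (extended) `C^{k,r}` norm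
of `HolderNorm.lean` (Gilbarg–Trudinger §4.1, (4.6)). [cite: GilbargTrudinger2001, §4.1 (4.6)] -/
theorem norm_eq_toReal_eContDiffHolderNorm (f : ContDiffHolderFunction E F k r) :
    ‖f‖ = (eContDiffHolderNorm k r (f : E → F)).toReal := by
  have hsup : ∀ j ∈ Finset.range (k + 1),
      eSupNorm (iteratedFDeriv ℝ j (f : E → F)) = ENNReal.ofReal (f.supNormDeriv j) := fun j hj =>
    f.eSupNorm_iteratedFDeriv_eq (Nat.lt_succ_iff.1 (Finset.mem_range.1 hj))
  rw [eContDiffHolderNorm, Finset.sum_congr rfl hsup,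
    ← f.memHolder.coe_nnHolderNorm_eq_eHolderNorm,
    ENNReal.toReal_add (ENNReal.sum_ne_top.2 fun _ _ => ENNReal.ofReal_ne_top) ENNReal.coe_ne_top,
    ENNReal.toReal_sum fun _ _ => ENNReal.ofReal_ne_top, ENNReal.coe_toReal, norm_def]
  congr 1
  exact Finset.sum_congr rfl fun j _ => (ENNReal.toReal_ofReal (f.supNormDeriv_nonneg j)).symm

/-! ### Evaluation -/

/-- **Evaluation at a point as a continuous linear map** (norm `≤ 1`). [folklore] -/
def evalCLM (x : E) : ContDiffHolderFunction E F k r →L[ℝ] F :=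
  LinearMap.mkContinuous
    { toFun := fun f : ContDiffHolderFunction E F k r => f x
      map_add' := fun f g => rfl
      map_smul' := fun c f => rfl } 1
    fun f : ContDiffHolderFunction E F k r => by simpa using f.norm_apply_le_norm x

/-- `evalCLM x f = f x`. [folklore] -/
@[simp]
theorem evalCLM_apply (x : E) (f : ContDiffHolderFunction E F k r) : evalCLM x f = f x := rfl

/-! ### Completeness (Evans 2010, §5.1, Theorem 1) -/

/-- Along a sequence, `‖D^j u_m(x) − D^j u_n(x)‖ ≤ ‖u_m − u_n‖` (`j ≤ k`). [folklore] -/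
theorem norm_iteratedFDeriv_sub_le (f g : ContDiffHolderFunction E F k r) {j : ℕ} (hj : j ≤ k)
    (x : E) : ‖iteratedFDeriv ℝ j (f : E → F) x - iteratedFDeriv ℝ j (g : E → F) x‖ ≤ ‖f - g‖ := by
  rw [← iteratedFDeriv_sub_apply' f g hj x]
  exact (f - g).norm_iteratedFDeriv_le_norm hj x

/-- **Hölder control of the tail of a Cauchy sequence** (the key step of Evans §5.1, Theorem 1,
for the top derivative): if `u` is Cauchy in `C^{k,r}_b` and `D^k u_n → G` pointwise, then for
every `ε > 0` eventually `D^k u_n − G` is `ε`-Hölder — pass to the limit `m → ∞` in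
`[D^k u_n − D^k u_m]_r ≤ ‖u_n − u_m‖ < ε`. [folklore] -/
theorem eventually_holderWith_iteratedFDeriv_sub {u : ℕ → ContDiffHolderFunction E F k r}
    (hu : CauchySeq u) {G : E → E [×k]→L[ℝ] F}
    (hpt : ∀ x, Tendsto (fun n => iteratedFDeriv ℝ k (u n : E → F) x) atTop (𝓝 (G x)))
    {ε : ℝ≥0} (hε : 0 < ε) :
    ∃ N, ∀ n ≥ N, HolderWith ε r (fun x => iteratedFDeriv ℝ k (u n : E → F) x - G x) := by
  obtain ⟨N, hN⟩ := Metric.cauchySeq_iff.1 hu ε (by exact_mod_cast hε)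
  refine ⟨N, fun n hn x y => ?_⟩
  have hm : ∀ m ≥ N,
      edist (iteratedFDeriv ℝ k (u n : E → F) x - iteratedFDeriv ℝ k (u m : E → F) x)
        (iteratedFDeriv ℝ k (u n : E → F) y - iteratedFDeriv ℝ k (u m : E → F) y)
        ≤ (ε : ℝ≥0∞) * edist x y ^ (r : ℝ) := by
    intro m hm
    have hd : ‖u n - u m‖ < ε := by
      rw [← dist_eq_norm]
      exact hN n hn m hm
    have hH : HolderWith (nnHolderNorm r (iteratedFDeriv ℝ k ((u n - u m : ContDiffHolderFunction E F k r) : E → F)))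
        r (iteratedFDeriv ℝ k ((u n - u m : ContDiffHolderFunction E F k r) : E → F)) :=
      (u n - u m).memHolder.holderWith
    have hle : nnHolderNorm r (iteratedFDeriv ℝ k ((u n - u m : ContDiffHolderFunction E F k r) : E → F)) ≤ ε := by
      have h1 := (u n - u m).nnHolderNorm_le_norm
      exact_mod_cast h1.trans hd.le
    have hxy := hH x y
    rw [iteratedFDeriv_sub_apply' _ _ le_rfl, iteratedFDeriv_sub_apply' _ _ le_rfl] at hxy
    exact hxy.trans (mul_le_mul' (ENNReal.coe_le_coe.2 hle) le_rfl)
  have hlim : Tendsto (fun m => edist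
      (iteratedFDeriv ℝ k (u n : E → F) x - iteratedFDeriv ℝ k (u m : E → F) x)
      (iteratedFDeriv ℝ k (u n : E → F) y - iteratedFDeriv ℝ k (u m : E → F) y)) atTop
      (𝓝 (edist (iteratedFDeriv ℝ k (u n : E → F) x - G x)
        (iteratedFDeriv ℝ k (u n : E → F) y - G y))) :=
    (tendsto_const_nhds.sub (hpt x)).edist (tendsto_const_nhds.sub (hpt y))
  exact le_of_tendsto hlim (eventually_atTop.2 ⟨N, hm⟩)

/-- **`C^{k,r}_b(E, F)` is a Banach space for complete `F`** (Evans 2010, §5.1, Theorem 1: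
"`C^{k,γ}(Ū)` is a Banach space"; Gilbarg–Trudinger 2001, §4.1). Proof: along a Cauchy sequence
`u`, every `D^j u_n` (`j ≤ k`) is uniformly Cauchy (`norm_iteratedFDeriv_sub_le`), hence
converges uniformly to some `G_j` (the targets `E [×j]→L[ℝ] F` are complete). Put `g = G_0`
(values). By induction on `j`, using Mathlib's `hasFDerivAt_of_tendstoUniformly` for the sequence
`D^j u_n` (whose derivatives `D^{j+1} u_n`, read through the currying isometry
`fderiv_iteratedFDeriv`, converge uniformly), `D^j g = G_j` for all `j ≤ k`, so `g` is `C^k`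
with bounded derivatives; `D^k g` is Hölder and `[D^k u_n − D^k g]_r → 0` by
`eventually_holderWith_iteratedFDeriv_sub`; and `sup_x ‖D^j u_n − D^j g‖ → 0` by uniform
convergence. [cite: Evans2010, §5.1 Theorem 1] -/
instance instCompleteSpace [CompleteSpace F] : CompleteSpace (ContDiffHolderFunction E F k r) := by
  refine Metric.complete_of_cauchySeq_tendsto fun u hu => ?_
  have hC : ∀ ε > (0 : ℝ), ∃ N, ∀ m ≥ N, ∀ n ≥ N, ‖u m - u n‖ < ε := fun ε hε => by
    simpa only [dist_eq_norm] using Metric.cauchySeq_iff.1 hu ε hε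
  -- every derivative level `j ≤ k` is uniformly Cauchy, hence converges uniformly
  have hUC : ∀ j : ℕ, j ≤ k →
      UniformCauchySeqOn (fun n => iteratedFDeriv ℝ j (u n : E → F)) atTop univ := by
    intro j hj
    rw [Metric.uniformCauchySeqOn_iff]
    intro ε hε
    obtain ⟨N, hN⟩ := hC ε hε
    exact ⟨N, fun m hm n hn x _ => by
      rw [dist_eq_norm]
      exact (norm_iteratedFDeriv_sub_le (u m) (u n) hj x).trans_lt (hN m hm n hn)⟩
  have hptC : ∀ j : ℕ, j ≤ k → ∀ x, CauchySeq fun n => iteratedFDeriv ℝ j (u n : E → F) x := by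
    intro j hj x
    rw [Metric.cauchySeq_iff]
    intro ε hε
    obtain ⟨N, hN⟩ := hC ε hε
    exact ⟨N, fun m hm n hn => by
      rw [dist_eq_norm]
      exact (norm_iteratedFDeriv_sub_le (u m) (u n) hj x).trans_lt (hN m hm n hn)⟩
  set G : (j : ℕ) → E → E [×j]→L[ℝ] F := fun j x =>
    limUnder atTop fun n => iteratedFDeriv ℝ j (u n : E → F) x with hGdef
  have hG : ∀ j : ℕ, j ≤ k → ∀ x,
      Tendsto (fun n => iteratedFDeriv ℝ j (u n : E → F) x) atTop (𝓝 (G j x)) :=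
    fun j hj x => tendsto_nhds_limUnder (cauchySeq_tendsto_of_complete (hptC j hj x))
  have hunif : ∀ j : ℕ, j ≤ k →
      TendstoUniformly (fun n => iteratedFDeriv ℝ j (u n : E → F)) (G j) atTop := by
    intro j hj
    rw [← tendstoUniformlyOn_univ]
    exact (hUC j hj).tendstoUniformlyOn_of_tendsto fun x _ => hG j hj x
  -- the limit function and its derivatives
  set g : E → F := fun x => continuousMultilinearCurryFin0 ℝ E F (G 0 x) with hgdef
  -- one step: if `D^j g = G_j` and `j < k` then `D^j g` has derivative `curry (G_{j+1})`
  have hstep : ∀ j : ℕ, j + 1 ≤ k → iteratedFDeriv ℝ j g = G j →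
      ∀ x, HasFDerivAt (iteratedFDeriv ℝ j g)
        (continuousMultilinearCurryLeftEquiv ℝ (fun _ : Fin (j + 1) => E) F (G (j + 1) x)) x := by
    intro j hj heq
    have hj' : j ≤ k := (Nat.le_succ j).trans hj
    -- derivatives of `D^j u_n`, read through the currying isometry, converge uniformly
    have hf' : TendstoUniformly (fun n => fderiv ℝ (iteratedFDeriv ℝ j (u n : E → F)))
        (fun x => continuousMultilinearCurryLeftEquiv ℝ (fun _ : Fin (j + 1) => E) F (G (j + 1) x))
        atTop := by
      refine (Metric.tendstoUniformly_iff (α := E →L[ℝ] (E [×j]→L[ℝ] F))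
        (F := fun n => fderiv ℝ (iteratedFDeriv ℝ j (u n : E → F)))
        (f := fun x => continuousMultilinearCurryLeftEquiv ℝ (fun _ : Fin (j + 1) => E) F
          (G (j + 1) x)) (p := atTop)).2 fun ε hε => ?_
      filter_upwards [Metric.tendstoUniformly_iff.1 (hunif (j + 1) hj) ε hε] with n hn x
      rw [fderiv_iteratedFDeriv, Function.comp_apply, LinearIsometryEquiv.dist_map]
      exact hn x
    have hf : ∀ n x, HasFDerivAt (iteratedFDeriv ℝ j (u n : E → F))
        (fderiv ℝ (iteratedFDeriv ℝ j (u n : E → F)) x) x := fun n x =>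
      (((u n).contDiff.differentiable_iteratedFDeriv (by exact_mod_cast hj)) x).hasFDerivAt
    have hfg : ∀ x, Tendsto (fun n => iteratedFDeriv ℝ j (u n : E → F) x) atTop
        (𝓝 (iteratedFDeriv ℝ j g x)) := fun x => by
      rw [heq]
      exact hG j hj' x
    exact hasFDerivAt_of_tendstoUniformly hf' hf hfg
  -- by induction, `D^j g = G_j` for all `j ≤ k`
  have hDg : ∀ j : ℕ, j ≤ k → iteratedFDeriv ℝ j g = G j := by
    intro j
    induction j with
    | zero =>
      intro _
      funext x
      rw [iteratedFDeriv_zero_eq_comp, Function.comp_apply]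
      exact (continuousMultilinearCurryFin0 ℝ E F).symm_apply_apply (G 0 x)
    | succ j ih =>
      intro hj
      have heq := ih ((Nat.le_succ j).trans hj)
      funext x
      rw [iteratedFDeriv_succ_eq_comp_left, Function.comp_apply, (hstep j hj heq x).fderiv]
      exact (continuousMultilinearCurryLeftEquiv ℝ (fun _ : Fin (j + 1) => E) F).symm_apply_apply _
  -- so `g` is `C^k` …
  have hgk : ContDiff ℝ k g := by
    refine contDiff_nat_iff_continuous_differentiable.2 ⟨fun m hm => ?_, fun m hm => ?_⟩
    · rw [show (fun x => iteratedFDeriv ℝ m g x) = G m from hDg m hm]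
      exact (hunif m hm).continuous (Eventually.of_forall fun n =>
        (u n).continuous_iteratedFDeriv hm).frequently
    · exact fun x => (hstep m hm (hDg m hm.le) x).differentiableAt
  -- … with bounded derivatives …
  have hbdd : ∀ j : ℕ, j ≤ k → ∃ C : ℝ, ∀ x, ‖G j x‖ ≤ C := by
    intro j hj
    obtain ⟨N, hN⟩ := eventually_atTop.1 (Metric.tendstoUniformly_iff.1 (hunif j hj) 1 one_pos)
    refine ⟨‖u N‖ + 1, fun x => ?_⟩
    have h1 : dist (G j x) (iteratedFDeriv ℝ j (u N : E → F) x) < 1 := hN N le_rfl x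
    rw [dist_eq_norm] at h1
    calc ‖G j x‖ = ‖(G j x - iteratedFDeriv ℝ j (u N : E → F) x) + iteratedFDeriv ℝ j (u N : E → F) x‖ := by
          rw [sub_add_cancel]
      _ ≤ ‖G j x - iteratedFDeriv ℝ j (u N : E → F) x‖ + ‖iteratedFDeriv ℝ j (u N : E → F) x‖ :=
          norm_add_le _ _
      _ ≤ 1 + ‖u N‖ := add_le_add h1.le ((u N).norm_iteratedFDeriv_le_norm hj x)
      _ = ‖u N‖ + 1 := add_comm _ _
  -- … and Hölder top derivative
  obtain ⟨N₁, hN₁⟩ := eventually_holderWith_iteratedFDeriv_sub hu (hG k le_rfl) one_pos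
  have hgH : MemHolder r (G k) := by
    have h1 : MemHolder r (fun x => iteratedFDeriv ℝ k (u N₁ : E → F) x - G k x) :=
      (hN₁ N₁ le_rfl).memHolder
    have h2 : MemHolder r (iteratedFDeriv ℝ k (u N₁ : E → F) +
        -(fun x => iteratedFDeriv ℝ k (u N₁ : E → F) x - G k x)) := (u N₁).memHolder.add h1.neg'
    convert h2 using 1
    funext x
    simp
  have hgmem : MemContDiffHolder k r g := by
    refine ⟨hgk, fun j hj => ?_, ?_⟩
    · rw [hDg j hj]
      exact eSupNorm_lt_top_iff.2 (hbdd j hj)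
    · rw [hDg k le_rfl]
      exact hgH
  set Glim : ContDiffHolderFunction E F k r := ⟨g, hgmem⟩ with hGlim
  have hGlimD : ∀ j : ℕ, j ≤ k → ∀ x, iteratedFDeriv ℝ j (Glim : E → F) x = G j x :=
    fun j hj x => congrFun (hDg j hj) x
  refine ⟨Glim, ?_⟩
  -- convergence in the norm: every term tends to `0`
  have hsup : ∀ j : ℕ, j ≤ k → Tendsto (fun n => (u n - Glim).supNormDeriv j) atTop (𝓝 0) := by
    intro j hj
    rw [Metric.tendsto_atTop]
    intro ε hε
    obtain ⟨N, hN⟩ := eventually_atTop.1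
      (Metric.tendstoUniformly_iff.1 (hunif j hj) (ε / 2) (half_pos hε))
    refine ⟨N, fun n hn => ?_⟩
    rw [Real.dist_eq, sub_zero, abs_of_nonneg ((u n - Glim).supNormDeriv_nonneg j)]
    have hle : (u n - Glim).supNormDeriv j ≤ ε / 2 := by
      refine supNormDeriv_le _ j (half_pos hε).le fun x => ?_
      rw [iteratedFDeriv_sub_apply' _ _ hj, hGlimD j hj x, ← dist_eq_norm, dist_comm]
      exact (hN n hn x).le
    linarith
  have htop : Tendsto (fun n => (nnHolderNorm r
      (iteratedFDeriv ℝ k ((u n - Glim : ContDiffHolderFunction E F k r) : E → F)) : ℝ))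
      atTop (𝓝 0) := by
    rw [Metric.tendsto_atTop]
    intro ε hε
    set ε' : ℝ≥0 := ⟨ε / 2, by positivity⟩ with hε'
    have hε'pos : 0 < ε' := by
      rw [hε', ← NNReal.coe_pos]
      show 0 < ε / 2
      positivity
    obtain ⟨N, hN⟩ := eventually_holderWith_iteratedFDeriv_sub hu (hG k le_rfl) hε'pos
    refine ⟨N, fun n hn => ?_⟩
    rw [Real.dist_eq, sub_zero, abs_of_nonneg (NNReal.coe_nonneg _)]
    have hfun : iteratedFDeriv ℝ k ((u n - Glim : ContDiffHolderFunction E F k r) : E → F) =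
        fun x => iteratedFDeriv ℝ k (u n : E → F) x - G k x :=
      funext fun x => by rw [iteratedFDeriv_sub_apply' _ _ le_rfl, hGlimD k le_rfl x]
    have hle : (nnHolderNorm r (iteratedFDeriv ℝ k ((u n - Glim : ContDiffHolderFunction E F k r) :
        E → F)) : ℝ) ≤ ε / 2 := by
      rw [hfun]
      have h := (hN n hn).nnholderNorm_le
      have h' : ((nnHolderNorm r fun x => iteratedFDeriv ℝ k (u n : E → F) x - G k x : ℝ≥0) : ℝ)
          ≤ (ε' : ℝ) := by exact_mod_cast h
      exact h'
    linarith
  rw [tendsto_iff_norm_sub_tendsto_zero]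
  have hsum : Tendsto (fun n => ∑ j ∈ Finset.range (k + 1), (u n - Glim).supNormDeriv j) atTop
      (𝓝 0) := by
    rw [show (0 : ℝ) = ∑ j ∈ Finset.range (k + 1), (0 : ℝ) by simp]
    exact tendsto_finsetSum _ fun j hj => hsup j (Nat.lt_succ_iff.1 (Finset.mem_range.1 hj))
  have hlim := hsum.add htop
  rw [add_zero] at hlim
  exact hlim

end ContDiffHolderFunction

end Literature.Analysis.FunctionSpaces

end
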